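import Summits.Ventures.QEC.Census.CertCoverBatch
import Summits.Ventures.QEC.Census.BB.S8_126_w6_k12_01061B01.CoreDefs
import HarnessLib

set_option Elab.async false
set_option maxRecDepth 200000

/-!
# `[[252,12,16]]` one-level cover certificate of `S8_126_w6_k12_01061B01` — LEVEL-1→0 coset problems 68…89 (deep problems [0] excluded: `ProbDeep*.lean`) as COMPACT data
(`ProbData`: U, f, σ, y₀, allow; qec-type-10 `CertCoverBatch.mkCoset` rebuilds each `CosetProb` in the kernel) + their verdict
`probsOK cov covR hx hx1 D1 lxd 14` (one `decide +kernel`; 22 problems, depths f=0:18 f=1:4 f=2:0 f=3:0, est. 95.0 s).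
qec-search-1 g5 (pattern of search-9 g5 `Probs*`); data from JSON `level10.problems` (sha256 75f002ace624d82a…). Data + decided check; KERNEL.
-/

namespace Summit.Ventures.QEC.Census.S8_126_w6_k12_01061B01

open Matrix Summit.Ventures.QEC.Census Literature.InformationTheory.QuantumCodes

/-- Problems 68…89 (22): `⟨U, f, σ, y₀, allow⟩`. -/
def probs06 : List ProbData := [
    ⟨12686411987682329466256828171272, 0, 1226176743161860128, 2535303656088182816713826402312, [0]⟩,
    ⟨12877091021505641488371916735496, 0, 1391974158368, 2696233443342490101687487823880, [0]⟩,
    ⟨25357963811955770674096275194896, 1, 1154049878414856256, 5075554198850143912372878704656, [0]⟩,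
    ⟨43112499855386694576974493385768, 0, 1154053177889263776, 43102596325618455195899509342216, [0]⟩,
    ⟨50715927576677500225679758722080, 1, 1154052078243418240, 40564819245083425632631149035520, [0]⟩,
    ⟨50715927690055800987617578718240, 0, 5770242796883562624, 10151108482714413729796172284960, [0]⟩,
    ⟨101431855106120959328846725776448, 1, 1154056476826800384, 20302216682060321295281575428160, [0]⟩,
    ⟨202863758512595929436083335463936, 0, 1154346474096562176, 162259315552619676125923224059904, [0]⟩,
    ⟨202982562070739945352839749436416, 0, 299086764838912, 162259286538398855173742810764801, []⟩,
    ⟨202982591094404348788204255052928, 0, 17886661841408, 40564857902383524858207117247616, [0]⟩,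
    ⟨811336036960183065013427227854336, 0, 70669662427136, 162259276866992295272404383433216, [0]⟩,
    ⟨811336152979282817280770748974080, 0, 1197669097672704, 39614090701879796154908044295, []⟩,
    ⟨811455033908681594376794966852608, 0, 1152993256615710720, 162417771839869272674272511262720, [0]⟩,
    ⟨1622672073873136700590360091426816, 0, 3462283277719568384, 324518553667882988999130046529536, [0]⟩,
    ⟨1622909687035234422082534650282000, 0, 1154223653060608064, 324835471153641018929827335372800, [0]⟩,
    ⟨1622909729337012784324758412984448, 0, 1154469634431255040, 324835475979899564457789116907648, [0]⟩,
    ⟨1622909874379776940027466439721472, 0, 1153063633949820928, 324835621060442652304929277870080, [0]⟩,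
    ⟨1623107761057671064579099780972672, 0, 422212739793408, 1298074224342892398914788882781697, []⟩,
    ⟨1623107790081335468014464286588928, 1, 141012636794880, 1298232670996514367671043209822208, [0]⟩,
    ⟨1623107906100435220281807807709696, 0, 1268012072044544, 1622751224617162168233568027290114, []⟩,
    ⟨1623860728424605725820081353523201, 0, 1154188571783987204, 324518863152890504501223921549313, [0]⟩,
    ⟨83178181615799413851596549742133249, 0, 10282771526189060, 81129657757429019042630143574017, [0]⟩]

set_option maxHeartbeats 400000000 in
/-- Every problem of this chunk passes (`mkCoset` elimination + `cosetOKD` + fast `σ` + depth + `BU`-evenness + label checks). -/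
theorem probs06_ok : probsOK S8_126_w6_k12_01061B01.cov covR hx hx1 D1 lxd 14 probs06 = true := by
  decide +kernel

/-- Pointwise form. -/
theorem probs06_all : ∀ x ∈ S8_126_w6_k12_01061B01.probs06, probOK cov covR hx hx1 D1 lxd 14 x = true := by
  have h := probs06_ok
  rwa [probsOK, List.all_eq_true] at h

end Summit.Ventures.QEC.Census.S8_126_w6_k12_01061B01
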